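import Mathlib
import HarnessLib
import Summits.ValiantsHypothesis.ValiantsHypothesis.Theses.MonotoneRestoration

/-! # Route MonotoneRestoration — crux `MonotoneRestorationQP`, line Sketch, stub N4
(stmt-ValiantsHypothesis-15886)

**`ℂ` has arbitrarily large algebraically independent families over `ℚ`.** For every `M : ℕ`
there are `M` complex numbers `c : Fin M → ℂ` algebraically independent over `ℚ`; these are the
generic coefficients used by the dimension-counting size lower bound of cycle 2 of line Sketch.

Proof (cardinality, folklore): take a transcendence basis `s` of `ℂ` over `ℚ`
(`exists_isTranscendenceBasis`). Since `ℂ` is an uncountable algebraically closed field and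
`#ℚ = ℵ₀`, the classification of algebraically closed fields
(`IsAlgClosed.cardinal_eq_cardinal_transcendence_basis_of_aleph0_lt'`) gives `#ℂ = #s`, so
`ℵ₀ < 𝔠 = #s` and `s` is infinite. Composing the inclusion `s → ℂ` with an embedding
`Fin M ↪ ℕ ↪ s` yields the required family (`AlgebraicIndependent.comp`).
-/

noncomputable section

-- `Summit.ValiantsHypothesis.ValiantsHypothesis.…` is the tree's mandated namespace (Sub = Summit).
set_option linter.dupNamespace false

namespace Summit.ValiantsHypothesis.ValiantsHypothesis.Theorems

open Cardinal

/-- Every transcendence basis of `ℂ` over `ℚ` indexed by a set of complex numbers is infinite: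
by the cardinality classification of algebraically closed fields its cardinality is `#ℂ = 𝔠`.
[folklore] -/
theorem infinite_of_isTranscendenceBasis_rat_complex {s : Set ℂ}
    (hs : IsTranscendenceBasis ℚ ((↑) : s → ℂ)) : Infinite s := by
  have hℂ : ℵ₀ < #ℂ := by
    rw [Cardinal.mk_complex]
    exact Cardinal.aleph0_lt_continuum
  have h : #ℂ = #s :=
    IsAlgClosed.cardinal_eq_cardinal_transcendence_basis_of_aleph0_lt' ((↑) : s → ℂ) hs
      Cardinal.mkRat.le hℂ
  exact Cardinal.infinite_iff.mpr (h ▸ hℂ.le)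

/-- **N4 — `ℂ` HAS ARBITRARILY LARGE ALGEBRAICALLY INDEPENDENT FAMILIES over `ℚ`** (crux
`MonotoneRestorationQP`, line Sketch; registered stub `stub_exists_algebraicIndependent_complex`):
for every `M` there is a family `c : Fin M → ℂ` algebraically independent over `ℚ`. A
transcendence basis of `ℂ/ℚ` is infinite (otherwise `ℂ` would be countable), and any `M` of its
elements are algebraically independent. [folklore] -/
theorem stub_exists_algebraicIndependent_complex (M : ℕ) :
    ∃ c : Fin M → ℂ, AlgebraicIndependent ℚ c := by
  obtain ⟨s, hs⟩ := exists_isTranscendenceBasis ℚ ℂ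
  haveI : Infinite s := infinite_of_isTranscendenceBasis_rat_complex hs
  let e : Fin M ↪ s := Fin.valEmbedding.trans (Infinite.natEmbedding s)
  exact ⟨Subtype.val ∘ e, hs.1.comp e e.injective⟩

end Summit.ValiantsHypothesis.ValiantsHypothesis.Theorems

end
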